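import Mathlib
import HarnessLib
import HarnessLib.Audit
import Summits.AnomalousDissipation.Statement
import Literature.Analysis.FluidPDE.StatisticalSolution
import Literature.Analysis.FunctionSpaces.TorusSobolevSpace
import Literature.Analysis.FluidPDE.StatisticalSolutions
import HarnessLib.Audit.Status.Attr

/-!
Route: Ensemble

DORMANT since 2026-08-24T13:38:13Z (reconciler: no traction for 6.8 d (last activity item-evidence-added at 2026-08-17T17:42:02Z); parked, not closed — `ledger route dormant route-AnomalousDissipation-Ensemble --off` to reactivate) — unstaffed, not closed; items shared with open routes are served there. `ledger route dormant <id> --off` reactivates.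

# Route Ensemble — AnomalousDissipation (Literature.Turb.ZerothLaw)

## Thesis X (words)
For some smooth steady divergence-free mean-zero force f: (a) the ENSEMBLE zeroth law holds —
Foias–Prodi
stationary statistical solutions μ_j at viscosities ν_j → 0 with uniformly bounded (integrable) mean
energy and
ensemble dissipation ν_j∫‖∇u‖²dμ_j ≥ ε > 0 (this is the Literature def
Literature.Analysis.FluidPDE.EnsembleZerothLawAt f,
[FMRT2001, Ch. V]); and (b) REALIZATION with ν-uniform constants: for every E, ε > 0 there is M =
M(f,E,ε) such
that every stationary statistical solution (any ν > 0) with mean energy ≤ E and dissipation ≥ ε is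
shadowed by
one global Leray–Hopf trajectory with limsup-mean energy ≤ M and limsup-mean dissipation ≥ ε/2.

## Thesis X (Lean, one line; elaborates, Sketch.lean C0)
∃ f, IsSmooth f ∧ IsDivFree f ∧ HasZeroMean f ∧ Literature.Analysis.FluidPDE.EnsembleZerothLawAt f ∧
∀ E ε, 0 < ε → ∃ M, ∀ ν μ, 0 < ν →
Torus.IsStationaryStatisticalSolution ν f μ → Integrable (‖·‖²) μ → Torus.ensembleEnergy μ ≤ E → ε ≤
Torus.ensembleDissipation ν μ →
∃ u₀ u, Torus.IsGlobalLerayHopf ν (fun _ => f) u₀ u ∧ meanEnergy u ≤ M ∧ ε/2 ≤ meanDissipation ν u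

## Assembly X → AnomalousDissipation
Unpack EnsembleZerothLawAt f into (ν_j, μ_j, E, ε); apply (b) at each j; M is j-independent. Direct.

## Why this line
Probabilistic/ergodic reformulation: it moves the problem to invariant measures, where stationarity
identities
(Foias–Prodi generator identity with the cylindrical test Φ(u) = φ((u,f))) give ν-UNIFORM
information for free —
crux #4, the ensemble Doering–Foias lower bound ∫|u|²dμ ≥ c(f) > 0 [DoeringFoias2002, §3; FMRT2001,
Ch. V] — and
where compactness (Krylov–Bogoliubov, Vishik–Fursikov trajectory measures [VishikFursikov1988;
FoiasRosaTemam2019],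
Markov selections [FlandoliRomito2008]) replaces the choice of initial data. Realization (b) is an
ergodic-decomposition/Chebyshev argument (ε̄ ≤ ‖f‖ Ē^{1/2} pathwise bounds the good component's
energy by
(2‖f‖E/ε)²) whose only non-soft input is lifting a Foias–Prodi measure to a shift-invariant measure
on LH
trajectories — known for time-average and Galerkin limits, open for general μ in 3-D; the crux
records exactly that.
The physics (a) is untouched but is now a statement about measures, the form in which K41 is
actually phrased
[Frisch1995, §6].

## Ranked cruxes
- #2 (hardest) ∃ f smooth div-free mean-zero, EnsembleZerothLawAt f. (Lean.)
- #3 Realization (clause (b) for all such f). (Lean.) Ergodic theory + Vishik–Fursikov lift.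
- #4 (provable calibration) ensemble Doering–Foias bound: f ≠ 0 ⇒ ∃ c > 0, ∀ ν ∈ (0,1], every
stationary
  statistical solution with integrable energy has ensembleEnergy μ ≥ c. (Lean.)
- #5 (negative side) ∀ f smooth div-free mean-zero, ¬EnsembleZerothLawAt f. (Lean.)

## Kill criteria
#5 proved closes the route (and, with FMRT time-average stationarity, essentially refutes the
problem).
#3 refuted (a stationary statistical solution not shadowed by any trajectory with comparable
budgets) ⇒ pivot to
time-average measures only (restate (a) over Torus.IsTimeAverageMeasure).

## Not decomposed yet
The trajectory-space measurable structure (would be a definition request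
`Torus.IsStationaryLHEnsemble` if #3 is
taken up); ergodic decomposition details; which f.

Rationale: WHY THIS LINE. Probabilistic/ergodic reformulation of the zeroth law: pass from Leray–Hopf
trajectories to Foias–Prodi stationary statistical solutions (FMRT2001 Ch. IV Def. 1.3 p.197, Thm
3.1 p.209, Thm 4.2; Ch. V §5 p.306), where the generator identity with cylindrical tests gives
ν-UNIFORM information for free (ensemble Doering–Foias energy floor, support
EnsembleDoeringFoiasLowerBound; DoeringFoias2002 §3, FJMRT2005 Prop. 4.1) and compactness
(Krylov–Bogoliubov, Vishik–Fursikov trajectory measures, FoiasRosaTemam2019 (arXiv:1606.02174);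
Markov selections, FlandoliRomito2008 (arXiv:math/0602612)) replaces the choice of initial data. The
summit splits as (a) the ENSEMBLE zeroth law for SOME smooth steady divergence-free mean-zero force,
crux EnsembleZerothLawSomeForce = ∃ f, Literature.Analysis.FluidPDE.EnsembleZerothLawAt f (the
physics, untouched but now a statement about measures, the form in which K41 is phrased, Frisch1995
§6), and (b) REALIZATION with ν-uniform constants, crux EnsembleRealization: every stationary
statistical solution with mean energy ≤ E and dissipation ≥ ε is shadowed by ONE global Leray–Hopf
trajectory with limsup-means ≤ M(f,E,ε) and ≥ ε/2 (ergodic decomposition + Birkhoff + Chebyshev with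
the pathwise bound ε̄ ≤ ‖f‖₂Ē^{1/2}, M = (2‖f‖₂E/ε)²; the one non-soft input is the lift of a
general Foias–Prodi μ to a shift-invariant law on trajectories, known for time-average and Galerkin
limits only). Imported area: ergodic theory / invariant measures of dissipative PDE. Deciding
theorem (rev 2, lake ok): closes : EnsembleZerothLawSomeForce → EnsembleRealization →
AnomalousDissipation (unpack the family (ν_j, μ_j, E, ε), M is j-independent, witnesses with
constants M and ε/2).
RANKED CRUXES. #2 EnsembleZerothLawSomeForce — ∃ smooth steady div-free mean-zero f with
EnsembleZerothLawAt f (why it might fail: it IS the zeroth law in measure form; every known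
stationary family obeys only E ≤ |f|²/(ν²λ₁), FMRT2001 (1.33); rigorous anomalies need ν- or
t-dependent forces, BrueDeLellis2023 arXiv:2207.06301 Thm 1.1, Cheskidov2023 arXiv:2311.04182 Thm
1.3). #3 EnsembleRealization — the ν-uniform shadowing clause (b) for all such f (why it might fail:
a diffuse Foias–Prodi μ in 3-D need not be carried by a shift-invariant measure on Leray–Hopf
trajectories; lift proved for time-average μ only, FoiasRosaTemam2019 Thm 5.5; non-Leray stationary
laws exist, arXiv:2208.08290). #5 EnsembleNeg — ∀ smooth steady f, ¬EnsembleZerothLawAt f (negative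
side of #2; physically expected false, Frisch1995 H3; force-robust estimates cannot prove it,
Cheskidov2023 Thm 1.3; staffed by refuters). Support #4 EnsembleDoeringFoiasLowerBound (provable
calibration of Torus.IsStationaryStatisticalSolution: f ≠ 0 ⇒ ensembleEnergy μ ≥ c(f) for ν ≤ 1).
Target #0 EnsembleThesis = #2 ∧ (b) at the same f; Assembly #1 (elementary; candidate proof
proof0213.lean attached, rc 0).
KILL CRITERIA. EnsembleNeg proved closes the route (the ensemble programme for steady forcing is
dead); by itself it does NOT refute the summit — for time-average measures ensembleDissipation ≤
meanDissipation is the wrong direction (planner note 2026-08-13, enstrophy only lower-semicontinuous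
on H). EnsembleRealization refuted by an unshadowed stationary statistical solution with finite
budgets forces a PIVOT, not a close: restate (a) and (b) over Torus.IsTimeAverageMeasure
(time-average measures of Leray–Hopf trajectories only, where the lift exists by construction).
EnsembleZerothLawSomeForce refuted (= EnsembleNeg) kills the line and the ensemble programme for
steady forcing altogether.
NOT DECOMPOSED YET. The trajectory-space measurable structure of the Vishik–Fursikov lift (a
definition request Torus.IsStationaryLHEnsemble only once #3 is taken up); the
ergodic-decomposition/Chebyshev bookkeeping of (b) (foreseen glued split of EnsembleRealization into
LIFT → SELECTION, k = 2); the choice of f in (a). needs-fact: NONE — the closed facts of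
Literature.Analysis.FluidPDE.StatisticalSolutions in the import cone (EnsembleZerothLaw,
timeAverage_isStationary, fmrt_existence, exists_timeAverageMeasure) are hypotheses of no item; that
module is imported only for the vocabulary EnsembleZerothLawAt; EnsembleZerothLaw (∀ f ≠ 0) is an
open conjecture STRONGER than crux #2 and is not debt of this route (gate cone rev 2: 0 unproved
deps, staffable).
CHEAPEST FALSIFIER. For (b): finitely supported stationary measures cannot kill it (a convex
combination of Diracs at steady states of one force at one ν, isStationaryStatisticalSolution_dirac:
Chebyshev with the steady energy identity ν‖∇u‖² = (f,u) ≤ ‖f‖₂|u| selects one steady state with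
dissipation ≥ ε/2 and energy ≤ (2‖f‖₂E/ε)²), and the finite-dimensional (Galerkin) analogue of (b)
is a theorem with the same M (invariant measures live on the absorbing ball; ergodic decomposition +
Birkhoff), so no cheap finite-dimensional counterexample exists; hence the cheapest genuine test is
the literature lookup already flagged on #3 — is there a Foias–Prodi stationary statistical solution
in 3-D that is not the marginal of any Vishik–Fursikov stationary measure (FoiasRosaTemam2019 p.3:
open)? A positive answer with finite energy/enstrophy budgets refutes EnsembleRealization as stated.
For (a) nothing is cheap (it is the conjecture); the cheap CONSISTENCY check is support #4.

Novelty: Searched 2026-08-14 (lit search --hybrid; lit frontier --since 2020, none statistical; lit read of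
hits). Nearest prior art: FMRT2001 Ch. IV Def. 1.3, Thm 3.1, Ch. V §5 p.306 (stationary statistical
solutions; heuristic family μ^{ν,ε}) — conjunct (a) = EnsembleZerothLawAt is their conjecture in
measure form, nothing proved; ConstantinRamos2007, ConstantinTarfuleaVicol2013 (arXiv:1305.7089 §1,
§§4-7): "time-average first, then ν→0" via stationary statistical solutions proves ABSENCE of
anomaly (enstrophy: damped 2-D NS; energy: critical SQG); p.3 records bounded stationary families
with bounded dissipation on the torus as open; arXiv:2110.04674 (Foias-Prodi = correlation measures;
Euler statistical limit under weak scaling; no dissipation bound); FoiasRosaTemam2019 Thm 5.5 (only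
TIME-AVERAGE stationary μ are shown to lift to invariant Vishik-Fursikov measures); DoeringFoias2002
§3, FJMRT2005 Prop. 4.1 (ν-uniform energy lower bound for time averages); contrast arXiv:1803.09695
(white forcing pins ε; uniform energy open). Delta: summit split as (a) + REALIZATION with ν-uniform
M(f,E,ε): every Foias-Prodi stationary μ with energy ≤ E, dissipation ≥ ε is shadowed by one
Leray-Hopf trajectory with limsup-means ≤ M, ≥ ε/2 (ergodic decomposition + Chebyshev; one hard
input = FP→VF lift beyond time averages, crux EnsembleRealization), not found in print;
Doering-Foias bound moved to arbitrary FP measures via the generator identity. No new mechanism is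
claimed for (a).  [refs: 1305.7089, 2110.04674, 1803.09695, FMRT2001, ConstantinRamos2007, ConstantinTarfuleaVicol2013, FoiasRosaTemam2019, DoeringFoias2002, FJMRT2005]

Barriers (technique_class: stationary-statistical-solutions ergodic long-time-averages): Literature.Barriers.AnomalousDissipation.Cheskidov2023_thm13_not_forceRobustNoAnomaly: bites the
negative crux EnsembleNeg — Doering-Foias-type estimates are stable under C(R;L²)-perturbations of
f, where the bound is attained (Thm 1.3); NOT evaded: a proof of EnsembleNeg must use exact
steadiness and ν-independence of f.
Literature.Barriers.AnomalousDissipation.AlexakisDoering2006_energyDissipationBound: the d=2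
analogue of (a) is false (arXiv:1305.7089: same via stationary measures); inherited: witnesses μ_j
must be genuinely 3-D. Literature.Barriers.AnomalousDissipation.Marchioro1986_globalAttraction:
first-shell f with B(f,f)=0 carries the laminar Dirac at f/(νλ₁) (energy ~ ν⁻², killed by the energy
clause); (a) needs measures off the laminar branch — constraint on f.
Literature.Barriers.AnomalousDissipation.DrivasEyink2019_lemma1: the μ_j must charge Onsager-rough
fields (no ν-uniform B^σ_{3,∞}, σ>1/3, bound on typical trajectories); inherited via (b).
Literature.Barriers.AnomalousDissipation.Cheskidov2023_thm21_noDissipationAnomaly: evaded by design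
— dissipation is ν∫‖∇u‖²dμ at ν>0, no Euler-limit energy defect used (would bite a later step "μ_ν ⇀
Euler statistical solution").
Literature.Barriers.AnomalousDissipation.BrueDeLellis2023_noAnomaly_beforeEulerSingularity (and
BrenierDeLellisSzekelyhidi2011_cor1): finite-time fixed-data; the route takes t→∞ before ν→0, their
listed evasion. Convex-integration, shear-flow, intermittency, scalar barriers: unused classes.

Novelty grade: variant — ROUTE REVIEW grade (refuter, 2026-08-15). variant: the physics crux (a) = EnsembleZerothLawAt for some steady f is the Foias–Manley–Rosa–Temam ensemble programme in measure form exactly as published (FMRT2001 Ch. V §5 p.306, family μ^{ν,ε}; no theorem there, none since — BrueDeLellis2023 Q1–2 open;  (refuter refuter-rreview1-AnomalousDissipation-Ensemble-9f9c81e2-0, 2026-08-15T18:26:07Z; prior: FMRT2001 Ch. IV Def. 1.3, Thm 3.1/4.2; Ch. V §5 p.306 (ensemble programme μ^{ν,ε}), FoiasRosaTemam2019 arXiv:1606.02174 Def. 4.1-4.3, Thm 3.3, Thm 5.5, ConstantinTarfuleaVicol2013 arXiv:1305.7089 §1, §§4-7, ConstantinRamos2007, DoeringFoias2002 §3 / FJMRT2005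 Prop. 4.1, arXiv:2110.04674, arXiv:1803.09695)

History (route lifecycle, newest last):
- 2026-08-24T13:38:13Z · DORMANT — reconciler: no traction for 6.8 d (last activity item-evidence-added at 2026-08-17T17:42:02Z); parked, not closed — `ledger route dormant route-AnomalousDissipa (operator:999:1526067)

sub-problem: AnomalousDissipation · status: dormant · opened planner-AnomalousDissipation-Survey-0 2026-08-13T06:06:43Z · rev 4 · ledger route-AnomalousDissipation-Ensemble
GENERATED by the gate from the ledger (D-0016/17). Provers cite these decls: `theorem foo : Summit.AnomalousDissipation.AnomalousDissipation.Theses.Ensemble.<Decl> := …` in Summits/AnomalousDissipation/AnomalousDissipation/Theorems/<Name>.lean.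
-/

namespace Summit.AnomalousDissipation.AnomalousDissipation.Theses.Ensemble

open scoped BigOperators Topology Manifold Classical MeasureTheory ProbabilityTheory Matrix InnerProductSpace ComplexConjugate ContinuousMap
open Filter Set Function TopologicalSpace MeasureTheory

attribute [summit_statement] _root_.AnomalousDissipation

open Literature.Turb

/-- item stmt-AnomalousDissipation-0212 · target · rank 0 · open · by planner
why it might fail: (a) is the zeroth law itself for a FIXED steady f — open; all rigorous anomalies use ν- or t-dependent forces (BrueDeLellis2023 Thm 1.1, Q.1-2; Cheskidov2023 Thm 1.3). (b) fails if a diffuse Foias-Prodi μ is not carried by Leray-Hopf trajectory laws (lift known for time averages only, FRT2019 5.5).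
sources: FMRT2001 Ch. IV Def. 1.3 p.197, (1.33)-(1.34) p.198; Ch. V §5 p.306, BrueDeLellis2023 (arXiv:2207.06301) Thm 1.1, Questions 1-2, Cheskidov2023 (arXiv:2311.04182) §1.2, Thm 1.3, FoiasRosaTemam2019 (arXiv:1606.02174) pp.3-4, Def. 4.1-4.3, Thm 5.5, ConstantinTarfuleaVicol2013 (arXiv:1305.7089) p.3
EnsembleZerothLawAt f (Literature turb.S08, FMRT2001 Ch. V) ∧ ∀ E ε>0 ∃ M(f,E,ε) ∀ ν>0 ∀ Foias–Prodi
stationary statistical solution μ with ∫|u|²dμ ≤ E, ν∫‖∇u‖²dμ ≥ ε: ∃ global LH trajectory with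
limsup-mean energy ≤ M and limsup-mean dissipation ≥ ε/2. Sources: FMRT2001, VishikFursikov1988,
FoiasRosaTemam2019, FlandoliRomito2008. -/
@[route_item "route-AnomalousDissipation-Ensemble"]
def EnsembleThesis : Prop :=
  ∃ f : UnitAddTorus (Fin 3) → EuclideanSpace ℝ (Fin 3), Literature.Analysis.FunctionSpaces.Torus.IsSmooth f ∧ Literature.Analysis.FunctionSpaces.Torus.IsDivFree f ∧ Literature.Analysis.FunctionSpaces.Torus.HasZeroMean f ∧ Literature.Analysis.FluidPDE.EnsembleZerothLawAt f ∧ ∀ (E ε : ℝ), 0 < ε → ∃ M : ℝ, ∀ (ν : ℝ) (μ : MeasureTheory.Measure (Literature.Analysis.FunctionSpaces.Torus.energySpace (Fin 3))), 0 < ν → Literature.Analysis.FluidPDE.Torus.IsStationaryStatisticalSolution ν f μ → MeasureTheory.Integrable (fun u => ‖u‖ ^ 2) μ → Literature.Analysis.FluidPDE.Torus.ensembleEnergy μ ≤ E → ε ≤ Literature.Analysis.FluidPDE.Torus.ensembleDissipation ν μ → ∃ (u₀ : UnitAddTorus (Fin 3) → EuclideanSpace ℝ (Fin 3)) (u : ℝ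 → UnitAddTorus (Fin 3) → EuclideanSpace ℝ (Fin 3)), Literature.Analysis.FluidPDE.Torus.IsGlobalLerayHopf ν (fun _ => f) u₀ u ∧ Literature.Analysis.FluidPDE.meanEnergy u ≤ M ∧ ε / 2 ≤ Literature.Analysis.FluidPDE.meanDissipation ν u

/-- item stmt-AnomalousDissipation-0214 · crux · rank 2 · open · by planner
why it might fail: It IS the zeroth law in measure form: known stationary measures (time averages, Galerkin limits, Diracs at steady states) only obey E ≤ |f|²/(ν²λ₁) (FMRT2001 (1.33)); rigorous anomalies need ν- or t-dependent f (BrueDeLellis2023, Cheskidov2023); may fail for all f as in 2-D (Alexakis-Doering).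
sources: FMRT2001 Ch. IV (1.33)-(1.34) p.198; Ch. V §5 p.306 (family μ^{ν,ε}: programme, no theorem), BrueDeLellis2023 (arXiv:2207.06301) Thm 1.1; p.5 Questions 1-2 (ν-independent / time-independent force: open), Cheskidov2023 (arXiv:2311.04182) §1.2, Thm 1.3, ConstantinTarfuleaVicol2013 (arXiv:1305.7089) p.3: bounded stationary families / bounded mean dissipation on the torus are open, Literature.Barriers.AnomalousDissipation.AlexakisDoering2006_energyDissipationBound; Literature.Barriers.AnomalousDissipation.Marchioro1986_globalAttraction, Frisch1995 §5.2 p.42, H3 p.52; KanedaEtAl2003 (DNS: evidence for, not proof)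
The physics in measure form. Weaker than Literature EnsembleZerothLaw (which is ∀ f ≠ 0). Tools:
Foias–Prodi identity, Krylov–Bogoliubov limits of Galerkin invariant measures (FMRT2001 Ch. IV–V). -/
@[route_item "route-AnomalousDissipation-Ensemble", crux]
def EnsembleZerothLawSomeForce : Prop :=
  ∃ f : UnitAddTorus (Fin 3) → EuclideanSpace ℝ (Fin 3), Literature.Analysis.FunctionSpaces.Torus.IsSmooth f ∧ Literature.Analysis.FunctionSpaces.Torus.IsDivFree f ∧ Literature.Analysis.FunctionSpaces.Torus.HasZeroMean f ∧ Literature.Analysis.FluidPDE.EnsembleZerothLawAt f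

/-- item stmt-AnomalousDissipation-0215 · crux · rank 3 · open · by planner
why it might fail: A diffuse Foias-Prodi stationary μ in 3-D need not be a marginal of a shift-invariant measure on Leray-Hopf trajectories: VF-stationary ⊂ FP-stationary, lift proved for time-average μ only (FRT2019 Thm 5.5); an unshadowed spurious μ breaks (b). Non-Leray stationary NS laws exist (arXiv:2208.08290).
sources: FoiasRosaTemam2019 (arXiv:1606.02174) p.3 (VF ⊂ Foias-Prodi), Def. 4.1-4.3 p.20, Thm 3.3 p.18, Thm 5.5 p.27, FMRT2001 Ch. IV Thm 3.1 p.209 (time-average measures are stationary), FlandoliRomito2008 (arXiv:math/0602612) Thm 4.1 (Markov selections: no energy/dissipation control), arXiv:2208.08290 Hofmanova-Zhu-Zhu, non-unique ergodicity: stationary non-Leray laws for deterministic 3-D NS (H^θ, infinite enstrophy — outside Torus.IsStationaryStatisticalSolution, but a warning), VishikFursikov1988 (trajectory statistical solutions; background)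
Sketch: lift μ to a shift-invariant measure on LH trajectories (Vishik–Fursikov; known for
time-average/Galerkin limits, OPEN for general Foias–Prodi μ in 3-D — FoiasRosaTemam2019), Birkhoff
for the two observables, pathwise ε̄ ≤ ‖f‖₂ Ē^{1/2} (from crux Correlation #6), Chebyshev: some
generic trajectory has ε̄ ≥ ε/2 and Ē ≤ (2‖f‖₂E/ε)² ∨ … ; restart LH at a generic time. If false for
general μ, restate over Torus.IsTimeAverageMeasure. -/
@[route_item "route-AnomalousDissipation-Ensemble", crux]
def EnsembleRealization : Prop :=
  ∀ f : UnitAddTorus (Fin 3) → EuclideanSpace ℝ (Fin 3), Literature.Analysis.FunctionSpaces.Torus.IsSmooth f → Literature.Analysis.FunctionSpaces.Torus.IsDivFree f → Literature.Analysis.FunctionSpaces.Torus.HasZeroMean f → ∀ (E ε : ℝ), 0 < ε → ∃ M : ℝ, ∀ (ν : ℝ) (μ : MeasureTheory.Measure (Literature.Analysis.FunctionSpaces.Torus.energySpace (Fin 3))), 0 < ν → Literature.Analysis.FluidPDE.Torus.IsStationaryStatisticalSolution ν f μ → MeasureTheory.Integrable (fun u => ‖u‖ ^ 2) μ → Literature.Analysis.FluidPDE.Torus.ensembleEnergy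 μ ≤ E → ε ≤ Literature.Analysis.FluidPDE.Torus.ensembleDissipation ν μ → ∃ (u₀ : UnitAddTorus (Fin 3) → EuclideanSpace ℝ (Fin 3)) (u : ℝ → UnitAddTorus (Fin 3) → EuclideanSpace ℝ (Fin 3)), Literature.Analysis.FluidPDE.Torus.IsGlobalLerayHopf ν (fun _ => f) u₀ u ∧ Literature.Analysis.FluidPDE.meanEnergy u ≤ M ∧ ε / 2 ≤ Literature.Analysis.FluidPDE.meanDissipation ν u

/-- item stmt-AnomalousDissipation-0217 · crux · rank 5 · open · by planner
why it might fail: Logically ¬(0214), physically expected FALSE: K41/DNS give ε → ε∞ > 0 at bounded energy under large-scale steady forcing (Frisch1995 H3; KanedaEtAl2003). Force-robust estimates cannot prove it (Cheskidov2023 Thm 1.3 barrier); only 2-D mechanisms give ν-uniform decay (AlexakisDoering2006, CTV2013).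
sources: Literature.Barriers.AnomalousDissipation.Cheskidov2023_thm13_not_forceRobustNoAnomaly (arXiv:2311.04182 Thm 1.3), Frisch1995 §5.2 p.42, H3 p.52; KanedaEtAl2003, ConstantinTarfuleaVicol2013 (arXiv:1305.7089) §§4-7 (the 2-D/SQG engine: stationary measures ⇀ inviscid stationary measures with energy balance), Literature.Barriers.AnomalousDissipation.AlexakisDoering2006_energyDissipationBound, FMRT2001 Ch. IV (1.33) p.198 (only ν-dependent bounds known)
Negative side of #2. With FMRT time-average stationarity (Literature timeAverage_isStationary) and
Correlation #6 this essentially refutes the problem; staff with refuters. -/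
@[route_item "route-AnomalousDissipation-Ensemble"]
def EnsembleNeg : Prop :=
  ∀ f : UnitAddTorus (Fin 3) → EuclideanSpace ℝ (Fin 3), Literature.Analysis.FunctionSpaces.Torus.IsSmooth f → Literature.Analysis.FunctionSpaces.Torus.IsDivFree f → Literature.Analysis.FunctionSpaces.Torus.HasZeroMean f → ¬ Literature.Analysis.FluidPDE.EnsembleZerothLawAt f

/-- item stmt-AnomalousDissipation-0216 · support · rank 4 · open · by planner
sources: FJMRT2005 Lemma 4.1 p.12, Prop. 4.1 pp.14-16 (two-term ν-uniform lower bound on mean energy, finite-time averages), DoeringFoias2002 §3 (Re ≳ Gr^{1/2}; paywalled, acq-00001), FMRT2001 Ch. IV p.197 (admissible cylindrical tests ψ((u,g₁),...,(u,g_m)))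
Foias–Prodi generator identity with cylindrical tests Φ(u) = φ_R((u,f)), R → ∞: ∫(u⊗u : ∇f)dμ =
‖f‖₂² + ν∫(u,Δf)dμ, whence ‖f‖₂² ≤ ‖∇f‖_∞ ∫|u|²dμ + ν‖Δf‖₂ (∫|u|²dμ)^{1/2}. DoeringFoias2002 §3 (Re
≳ Gr^{1/2}); FMRT2001 Ch. V. Checks that Torus.IsStationaryStatisticalSolution is strong enough to
be useful. -/
@[route_item "route-AnomalousDissipation-Ensemble"]
def EnsembleDoeringFoiasLowerBound : Prop :=
  ∀ f : UnitAddTorus (Fin 3) → EuclideanSpace ℝ (Fin 3), Literature.Analysis.FunctionSpaces.Torus.IsSmooth f → Literature.Analysis.FunctionSpaces.Torus.IsDivFree f → Literature.Analysis.FunctionSpaces.Torus.HasZeroMean f → f ≠ 0 → ∃ c : ℝ, 0 < c ∧ ∀ (ν : ℝ) (μ : MeasureTheory.Measure (Literature.Analysis.FunctionSpaces.Torus.energySpace (Fin 3))), 0 < ν → ν ≤ 1 → Literature.Analysis.FluidPDE.Torus.IsStationaryStatisticalSolution ν f μ → MeasureTheory.Integrable (fun u => ‖u‖ ^ 2) μ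 → c ≤ Literature.Analysis.FluidPDE.Torus.ensembleEnergy μ

/-- item stmt-AnomalousDissipation-14158 · support · rank 9 · open · by planner
[support] glue (route-choice repair, target-unreachable): the two positive cruxes imply the target —
take the force f of crux #2 EnsembleZerothLawSomeForce and instantiate the ν-uniform realization
clause of crux #3 EnsembleRealization at that f; two lines of logic (candidate proof: planner
Sketch.lean `ensembleThesisOfCruxes_holds`, lean check rc 0, 0 sorry). [deps:
EnsembleZerothLawSomeForce, EnsembleRealization, EnsembleThesis] [difficulty: S, provable-now] -/
@[route_item "route-AnomalousDissipation-Ensemble"]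
def EnsembleThesisOfCruxes : Prop :=
  EnsembleZerothLawSomeForce → EnsembleRealization → EnsembleThesis

/-- item stmt-AnomalousDissipation-0213 · assembly · rank 1 · open · by planner
unpack EnsembleZerothLawAt f, apply realization at each j with the j-independent M. -/
@[route_item "route-AnomalousDissipation-Ensemble"]
def Assembly : Prop :=
  (∃ f : UnitAddTorus (Fin 3) → EuclideanSpace ℝ (Fin 3), Literature.Analysis.FunctionSpaces.Torus.IsSmooth f ∧ Literature.Analysis.FunctionSpaces.Torus.IsDivFree f ∧ Literature.Analysis.FunctionSpaces.Torus.HasZeroMean f ∧ Literature.Analysis.FluidPDE.EnsembleZerothLawAt f ∧ ∀ (E ε : ℝ), 0 < ε → ∃ M : ℝ, ∀ (ν : ℝ) (μ : MeasureTheory.Measure (Literature.Analysis.FunctionSpaces.Torus.energySpace (Fin 3))), 0 < ν → Literature.Analysis.FluidPDE.Torus.IsStationaryStatisticalSolution ν f μ → MeasureTheory.Integrable (fun u => ‖u‖ ^ 2) μ → Literature.Analysis.FluidPDE.Torus.ensembleEnergy μ ≤ E → ε ≤ Literature.Analysis.FluidPDE.Torus.ensembleDissipation ν μ → ∃ (u₀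 : UnitAddTorus (Fin 3) → EuclideanSpace ℝ (Fin 3)) (u : ℝ → UnitAddTorus (Fin 3) → EuclideanSpace ℝ (Fin 3)), Literature.Analysis.FluidPDE.Torus.IsGlobalLerayHopf ν (fun _ => f) u₀ u ∧ Literature.Analysis.FluidPDE.meanEnergy u ≤ M ∧ ε / 2 ≤ Literature.Analysis.FluidPDE.meanDissipation ν u) → AnomalousDissipation

/-! D-0027 §2.1 — DECIDING THEOREM (planner-authored via `route open/edit --closes-file`; by planner-rbadge-AnomalousDissipation-Ensemble-9f9c81e2-g2-0 2026-08-15T16:14:32Z):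
its hypotheses are this route's items and its conclusion the sub-problem Statement (glue_lint), and it elaborates with this file. -/

@[closes "route-AnomalousDissipation-Ensemble"] theorem closes : EnsembleZerothLawSomeForce → EnsembleRealization → _root_.AnomalousDissipation := by
  -- D-0027 §2.1 deciding theorem: the two positive cruxes decide the sub-problem.
  -- Unpack the force `f` and the Foias–Prodi family `(ν j, μ j)` with energy bound `E` and dissipation
  -- floor `ε`; `EnsembleRealization` at `(f, E, ε)` gives ONE `j`-independent `M` and, for every `j`, a
  -- global Leray–Hopf trajectory with `meanEnergy ≤ M`, `meanDissipation ≥ ε / 2`: these witness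
  -- `Literature.Turb.ZerothLaw` (= `AnomalousDissipation`) with the constants `M` and `ε / 2`.
  rintro ⟨f, hfs, hfd, hfz, ν, μ, hν, hν0, hstat, hint, ⟨E, hE⟩, ε, hε, hεμ⟩ hR
  obtain ⟨M, hM⟩ := hR f hfs hfd hfz E ε hε
  choose u₀ u hu using fun j => hM (ν j) (μ j) (hν j) (hstat j) (hint j) (hE j) (hεμ j)
  unfold _root_.AnomalousDissipation Literature.Turb.ZerothLaw
  exact ⟨f, hfs, hfd, hfz, ν, u₀, u, hν, hν0, fun j => (hu j).1, ⟨M, fun j => (hu j).2.1⟩,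
    ε / 2, half_pos hε, fun j => (hu j).2.2⟩

end Summit.AnomalousDissipation.AnomalousDissipation.Theses.Ensemble
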